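import Literature.NumberTheory.Automorphic.ClozelAlgebraicityConjugatesProofs
import Literature.NumberTheory.Automorphic.AutomorphicRepDataConj
import HarnessLib

/-!
# Clozel's algebraicity fact at `σ = c`: the complex conjugate of a cuspidal representation (proofs)

Companion of `ClozelAlgebraicity.lean` (whose named fact `Clozel1990_regularAlgebraic` renders
Clozel 1990, Thm. 3.13) for the one automorphism of `ℂ` that acts on automorphic forms directly,
complex conjugation `c`. With the conjugate `π̄ = W̄ / W̄'` of an automorphic representation datum
(`AutomorphicRepData.conj`, file `AutomorphicRepDataConj`) this file proves, for `GL_n` over a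
number field `K`:

* `CuspConditionGL.star`, `IsCuspFormGL.star`, `star_mem_cuspFormsGL` — conjugates of cusp forms
  are cusp forms (`∫ φ̄ = \overline{∫ φ}` over `N_k(K)\N_k(𝔸_K)`), hence the conjugate
  `CuspidalAutomorphicRepData.conj π` of a CUSPIDAL `π` is cuspidal (Borel–Jacquet 1979, 4.4–4.6);
* `AutomorphicRepData.HasSatakeParamAt.conj` — if `π` has Satake parameter `α` at `v` then `π̄`
  has Satake parameter `ᾱ = {ā : a ∈ α}` there: the double-coset operators
  `[K(𝔫) t_{v,i} K(𝔫)]` are real (`heckeOperator_rightTranslation_star`) and their eigenvalues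
  `q_v^{i(n-i)/2} e_i(α)` conjugate to `q_v^{i(n-i)/2} e_i(ᾱ)` (`starRingEnd_heckeEigenvalueOf`);
* `AutomorphicRepData.isAutConjugate_conj` — **`π̄` is the `c`-conjugate of `π` at almost all
  places** in the sense of `IsAutConjugate` (`t_{v,i}(π̄) = \overline{t_{v,i}(π)}` wherever `π` is
  unramified, i.e. at all but finitely many `v`, `hasSatakeParamAt_cofinite_holds`), and the
  cuspidal form `CuspidalAutomorphicRepData.exists_isAutConjugate_conj`: the finite part of
  clause (ii) of `Clozel1990_regularAlgebraic` for `σ = c`, unconditionally (Clozel 1990, §3.1 and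
  Thm. 3.13 at `σ = c`; Patrikis 2019, proof of Cor. 3.2.3, where `^cπ = π̄` is compared with `π^∨`).

No definitions beyond `CuspidalAutomorphicRepData.conj` (the cuspidal wrapper of
`AutomorphicRepData.conj`); no named facts; no `sorry`. The archimedean half of clause (ii) at
`σ = c` (the infinity type of `π̄` is `ι ↦ swap (T ι)`, whose `a`-multisets are those of `^cT`) is
left to a sibling file.

## References

* L. Clozel, *Motifs et formes automorphes: applications du principe de fonctorialité*, in
  Automorphic forms, Shimura varieties, and L-functions I (Ann Arbor 1988), Academic Press 1990,
  §3.1, Thm. 3.13 [Clozel1990].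
* S. Patrikis, *Variations on a theorem of Tate*, Mem. AMS 258 (2019) = arXiv:1207.6724,
  Cor. 3.2.3 [Patrikis2019].
* A. Borel, H. Jacquet, *Automorphic forms and automorphic representations*, Corvallis 1979,
  §4.4–4.6 [BorelJacquet1979].
* T. Tamagawa, *On the ζ-functions of a division algebra*, Ann. of Math. 77 (1963) [Tamagawa1963].
-/

noncomputable section

open scoped Classical
open NumberField IsDedekindDomain MeasureTheory

namespace Literature.NumberTheory.Automorphic

variable {n : ℕ} {K : Type} [Field K] [NumberField K]

/-! ### Conjugates of cusp forms are cusp forms -/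

/-- **Conjugation preserves the cusp condition**: `∫ φ̄(u g) du = \overline{∫ φ(u g) du} = 0` over a
fundamental domain of `N_k(K)` in `N_k(𝔸_K)` (and integrability is preserved).
Borel–Jacquet 1979, 4.4. [cite: BorelJacquet1979, 4.4] -/
theorem CuspConditionGL.star {φ : (AdelicGroupData.gl n K).Adelic → ℂ} {k : ℕ}
    (hφ : CuspConditionGL n K φ k) : CuspConditionGL n K (star φ) k := by
  intro ν _ 𝓕 h𝓕 g
  obtain ⟨hi, h0⟩ := hφ ν 𝓕 h𝓕 g
  refine ⟨?_, ?_⟩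
  · have h := (memLp_one_iff_integrable.2 hi).star
    exact memLp_one_iff_integrable.1 h
  · simp only [Pi.star_apply, RCLike.star_def]
    rw [integral_conj, h0, map_zero]

variable {hcpt : isCompact_glFiniteIntegralLevel n K}

/-- **The conjugate of a cusp form is a cusp form** (an automorphic form, `IsAutomorphicForm.star`,
with vanishing constant terms, `CuspConditionGL.star`). Borel–Jacquet 1979, 4.4. [cite: BorelJacquet1979, 4.4] -/
theorem IsCuspFormGL.star {φ : (AdelicGroupData.gl n K).Adelic → ℂ} (hφ : IsCuspFormGL n K hcpt φ) :
    IsCuspFormGL n K hcpt (star φ) :=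
  ⟨hφ.1.star _, fun k hk hkn ↦ (hφ.2 k hk hkn).star⟩

/-- The space of cusp forms `𝒜₀` is stable under conjugation. Borel–Jacquet 1979, 4.4–4.6. [cite: BorelJacquet1979, 4.4–4.6] -/
theorem star_mem_cuspFormsGL {φ : (AdelicGroupData.gl n K).Adelic → ℂ}
    (hφ : φ ∈ cuspFormsGL n K hcpt) : star φ ∈ cuspFormsGL n K hcpt := by
  refine Submodule.span_mono ?_ (star_mem_span_image_star hφ)
  rintro _ ⟨ψ, hψ, rfl⟩
  exact IsCuspFormGL.star hψ

/-- `\overline{𝒜₀} ≤ 𝒜₀`: a function whose conjugate is in the space of cusp forms is in it.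
Borel–Jacquet 1979, 4.4–4.6. [folklore] -/
theorem conjSubmodule_cuspFormsGL_le :
    conjSubmodule (cuspFormsGL n K hcpt) ≤ cuspFormsGL n K hcpt := by
  intro φ hφ
  have h := star_mem_cuspFormsGL hφ
  rwa [star_star] at h

/-- **The complex conjugate `π̄` of a cuspidal automorphic representation of `GL_n(𝔸_K)` is
cuspidal** (its forms `φ̄`, `φ ∈ W`, are cusp forms). Clozel 1990, §3.1 (`^cπ`); Patrikis 2019,
proof of Cor. 3.2.3; Borel–Jacquet 1979, 4.6. [cite: Clozel1990, §3.1] -/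
def CuspidalAutomorphicRepData.conj (π : CuspidalAutomorphicRepData n K hcpt) :
    CuspidalAutomorphicRepData n K hcpt :=
  ⟨π.1.conj, (conjSubmodule_mono π.2).trans conjSubmodule_cuspFormsGL_le⟩

/-- The underlying datum of the cuspidal conjugate is the conjugate datum (definitional). [folklore] -/
@[simp]
theorem CuspidalAutomorphicRepData.conj_val (π : CuspidalAutomorphicRepData n K hcpt) :
    π.conj.1 = π.1.conj :=
  rfl

/-- Conjugation of cuspidal representations is an involution. [folklore] -/
@[simp]
theorem CuspidalAutomorphicRepData.conj_conj (π : CuspidalAutomorphicRepData n K hcpt) :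
    π.conj.conj = π :=
  Subtype.ext π.1.conj_conj

/-! ### Satake parameters of the conjugate: `α ↦ ᾱ` -/

/-- Elementary symmetric functions commute with ring homomorphisms: `e_i(f(s)) = f(e_i(s))`
(here: with complex conjugation). [folklore] -/
theorem esymm_map_ringHom {R S : Type*} [CommSemiring R] [CommSemiring S] (f : R →+* S)
    (s : Multiset R) (i : ℕ) : (s.map f).esymm i = f (s.esymm i) := by
  simp only [Multiset.esymm, Multiset.powersetCard_map, Multiset.map_map, Function.comp_def,
    map_multiset_sum, ← Multiset.prod_hom]

/-- **The unramified Hecke eigenvalues of `ᾱ` are the conjugates of those of `α`**: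
`q_v^{i(n-i)/2} e_i(ᾱ) = \overline{q_v^{i(n-i)/2} e_i(α)}` (`q_v^{i(n-i)/2}` is real).
(Clozel 1990, §3.1: `^σπ_v` has the `σ`-conjugate Hecke eigenvalues, here `σ = c`.) [cite: Clozel1990, §3.1] -/
theorem starRingEnd_heckeEigenvalueOf (v : HeightOneSpectrum (𝓞 K)) (α : Multiset ℂ) (i : ℕ) :
    starRingEnd ℂ (heckeEigenvalueOf n v α i) = heckeEigenvalueOf n v (α.map (starRingEnd ℂ)) i := by
  rw [heckeEigenvalueOf, heckeEigenvalueOf, map_mul, map_pow, Complex.conj_ofReal,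
    esymm_map_ringHom]

namespace AutomorphicRepData

/-- **Satake parameters of the conjugate representation.** If `π = W / W'` has Satake parameter
`α` at `v` then `π̄` has Satake parameter `ᾱ = {ā : a ∈ α}` at `v`: with the same level `𝔫`,
uniformizer `ϖ` and the conjugate `φ̄ ∈ W̄ ∖ W̄'` of the `K(𝔫)`-fixed eigenform `φ`, since the
double-coset operators `[K(𝔫) t_{v,i} K(𝔫)]` commute with conjugation
(`heckeOperator_rightTranslation_star`) and `\overline{q_v^{i(n-i)/2} e_i(α)} = q_v^{i(n-i)/2} e_i(ᾱ)`.
(Clozel 1990, §3.1; for unitary `π_v`, `ᾱ` is the parameter of `π_v^∨ ≅ π̄_v`, Patrikis 2019,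
proof of Cor. 3.2.3.) [cite: Clozel1990, §3.1] -/
theorem HasSatakeParamAt.conj {π : AutomorphicRepData (AutomorphyDatum.gl n K hcpt)}
    {v : HeightOneSpectrum (𝓞 K)} {α : Multiset ℂ} (h : π.HasSatakeParamAt v α) :
    π.conj.HasSatakeParamAt v (α.map (starRingEnd ℂ)) := by
  obtain ⟨𝔫, ϖ, h𝔫, hv, hϖ, hcard, φ, hφW, hφW', hinv, heig⟩ := h
  refine ⟨𝔫, ϖ, h𝔫, hv, hϖ, by rw [Multiset.card_map, hcard], star φ,
    (star_mem_conjSubmodule_iff _ _).mpr hφW,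
    fun h' ↦ hφW' ((star_mem_conjSubmodule_iff _ _).mp h'), fun u hu ↦ ?_, fun i hi ↦ ?_⟩
  · rw [rightTranslation_star, hinv u hu]
  · have hc : ((((Real.sqrt (v.residueCard : ℝ)) : ℝ) : ℂ) ^ (i * (n - i))) *
        (α.map (starRingEnd ℂ)).esymm i =
        star (((((Real.sqrt (v.residueCard : ℝ)) : ℝ) : ℂ) ^ (i * (n - i))) * α.esymm i) := by
      rw [RCLike.star_def, map_mul, map_pow, Complex.conj_ofReal, esymm_map_ringHom]
    rw [hc, heckeOperator_rightTranslation_star, ← star_smul, ← star_sub]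
    exact (star_mem_conjSubmodule_iff _ _).mpr (heig i hi)

/-- Conversely, a Satake parameter of `π̄` is the conjugate of one of `π` (apply `conj` twice).
[folklore] -/
theorem HasSatakeParamAt.of_conj {π : AutomorphicRepData (AutomorphyDatum.gl n K hcpt)}
    {v : HeightOneSpectrum (𝓞 K)} {α : Multiset ℂ} (h : π.conj.HasSatakeParamAt v α) :
    π.HasSatakeParamAt v (α.map (starRingEnd ℂ)) := by
  simpa only [conj_conj] using h.conj

/-- `π̄` is unramified exactly where `π` is. [folklore] -/
theorem isUnramifiedAt_conj_iff (π : AutomorphicRepData (AutomorphyDatum.gl n K hcpt))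
    (v : HeightOneSpectrum (𝓞 K)) : π.conj.IsUnramifiedAt v ↔ π.IsUnramifiedAt v :=
  ⟨fun ⟨_, hα⟩ ↦ ⟨_, hα.of_conj⟩, fun ⟨_, hα⟩ ↦ ⟨_, hα.conj⟩⟩

/-! ### `π̄` is the `c`-conjugate of `π` (Clozel's relation at `σ = c`) -/

/-- **`π̄ = ^cπ` at almost all places.** For every automorphic representation `π` of
`GL_n(𝔸_K)` (Borel–Jacquet datum), the conjugate `π̄` is the `c`-conjugate of `π` in the sense of
`IsAutConjugate` (`c = Complex.conjAe`, complex conjugation in `Aut(ℂ) = (ℂ ≃ₐ[ℚ] ℂ)`): at every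
place where `π` is unramified — all but finitely many, `hasSatakeParamAt_cofinite_holds` (Flath) —
`π̄` is unramified with Hecke eigenvalues `t_{v,i}(π̄) = \overline{t_{v,i}(π)}`, `0 ≤ i ≤ n`.
This is the finite part of Clozel 1990, Thm. 3.13 (ii) for `σ = c`, valid for every `π` (no
regularity or algebraicity needed, as `c` acts on the forms themselves). [cite: Clozel1990, §3.1 and Thm. 3.13 (σ = c)] -/
theorem isAutConjugate_conj (π : AutomorphicRepData (AutomorphyDatum.gl n K hcpt)) :
    IsAutConjugate (Complex.conjAe.restrictScalars ℚ) π π.conj := by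
  change ∀ᶠ v : HeightOneSpectrum (𝓞 K) in Filter.cofinite, _
  filter_upwards [AutomorphicRepData.hasSatakeParamAt_cofinite_holds π] with v hv
  obtain ⟨α, hα⟩ := hv
  refine ⟨α, α.map (starRingEnd ℂ), hα, hα.conj, fun i _ ↦ ?_⟩
  rw [← starRingEnd_heckeEigenvalueOf]
  rfl

/-- Symmetrically, `π` is the `c`-conjugate of `π̄` (`c² = 1`). [folklore] -/
theorem isAutConjugate_conj_symm (π : AutomorphicRepData (AutomorphyDatum.gl n K hcpt)) :
    IsAutConjugate (Complex.conjAe.restrictScalars ℚ) π.conj π := by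
  simpa only [conj_conj] using isAutConjugate_conj π.conj

end AutomorphicRepData

/-- **Clause (ii) of Clozel's theorem at `σ = c`, finite part, unconditionally**: every cuspidal
automorphic representation `π` of `GL_n(𝔸_K)` has a CUSPIDAL `c`-conjugate at almost all places,
namely `π̄` (`CuspidalAutomorphicRepData.conj π`). Clozel 1990, Thm. 3.13 (ii) with `σ = c`
(there for regular algebraic `π`, via cuspidal cohomology; for `σ = c` conjugating the forms
suffices); Patrikis 2019, proof of Cor. 3.2.3. [cite: Clozel1990, Thm. 3.13 (σ = c)] -/
theorem CuspidalAutomorphicRepData.exists_isAutConjugate_conj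
    (π : CuspidalAutomorphicRepData n K hcpt) :
    ∃ π' : CuspidalAutomorphicRepData n K hcpt,
      IsAutConjugate (Complex.conjAe.restrictScalars ℚ) π.1 π'.1 :=
  ⟨π.conj, AutomorphicRepData.isAutConjugate_conj π.1⟩

/-- **Complex conjugation normalises the Hecke stabiliser**: `τ ∈ heckeStabilizer π̄ ↔
c τ c ∈ heckeStabilizer π` (`c⁻¹ = c`), i.e. `ℚ(π̄_f) = \overline{ℚ(π_f)}` — the case `σ = c` of
`ℚ(^σπ_f) = σ(ℚ(π_f))` (Clozel 1990, §3.1), by `mem_heckeStabilizer_iff_of_isAutConjugate`.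
[cite: Clozel1990, §3.1] -/
theorem AutomorphicRepData.mem_heckeStabilizer_conj_iff
    (π : AutomorphicRepData (AutomorphyDatum.gl n K hcpt)) (τ : ℂ ≃ₐ[ℚ] ℂ) :
    τ ∈ heckeStabilizer π.conj ↔
      (Complex.conjAe.restrictScalars ℚ)⁻¹ * τ * Complex.conjAe.restrictScalars ℚ ∈
        heckeStabilizer π :=
  mem_heckeStabilizer_iff_of_isAutConjugate (AutomorphicRepData.isAutConjugate_conj π) τ

/-- **`ℚ(π̄_f) = \overline{ℚ(π_f)}`**: `z ∈ ratField π̄ ↔ z̄ ∈ ratField π`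
(`mem_ratField_iff_of_isAutConjugate` at `σ = c`). Clozel 1990, §3.1. [cite: Clozel1990, §3.1] -/
theorem AutomorphicRepData.mem_ratField_conj_iff
    (π : AutomorphicRepData (AutomorphyDatum.gl n K hcpt)) (z : ℂ) :
    z ∈ ratField π.conj ↔ starRingEnd ℂ z ∈ ratField π := by
  rw [mem_ratField_iff_of_isAutConjugate (AutomorphicRepData.isAutConjugate_conj π) z]
  rfl

end Literature.NumberTheory.Automorphic
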